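import Mathlib
import Summits.PneNP.PneNP.Theses.OverlapGapAlgebra
import Summits.PneNP.PneNP.Theorems.SolvableImpliesStableSection.Negative.FalseWithoutSolvable

/-!
# Crux `SolvableImpliesStableSection` (stmt-PneNP-2463) — negative lemma:
# the efficiency conjunct `IsPolyTime f` is load-bearing (modulo the route's two printed theorems)

The crux (route OverlapGapAlgebra) reads `∀ k ≥ 3, ∀ α η ν > 0, (∃ f, IsPolyTime f ∧ f solves
F_k(n, ⌊α n⌋) with probability ≥ ε infinitely often) → Concl(k, α, η, ν)`.

**`solvableImpliesStableSection_false_without_polyTime_of`.**  Assuming the route's other two cruxes —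
`NoStableSection` (item 2462: Bresler–Huang 2021, Thm 2.6 read for all maps) and
`PositiveSatProbability` (item 2464: Achlioptas–Peres 2004, Thm 2) — the crux with the conjunct
`IsPolyTime f` DELETED is false (both the weakened hypothesis and the conclusion are inlined verbatim;
no new `Prop` definitions).  Proof (crux NOTES B1 made a theorem, at crux level): the
complexity-free solver `fStar` (on a codeword `encode L`, output SOME word satisfying `L` if one
exists — `Classical.choose` plus injectivity of `encodingCNF`) succeeds on every satisfiable instance
(`fStar_solves`), so by `PositiveSatProbability` it meets the weakened hypothesis at the window density
`α_k = 5·2^k log k / k`; the weakened crux then yields, infinitely often, a section with path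
probability `≥ e^{-cn/2}`, while `NoStableSection` bounds every section by `e^{-cn}` eventually —
the sandwich `e^{-cn/2} #paths ≤ count ≤ e^{-cn} #paths` is impossible for `n ≥ 1`.

Reading for provers: every construction of the section `g` that uses only the input/output behaviour
and the success probability of `f` is dead in the Bresler–Huang window; a proof of the crux must use
the polynomial-time MACHINE of `f` white-box (the route's recorded relativization caveat, sharpened:
the hypothesis minus efficiency is simply TRUE in the window).  Companion of the lead's stub-level
`transfer_false_without_polyTime` (about `stub_transfer`'s stronger conclusion); standing disprover,
cycle 1; work file `Cruxes/SolvableImpliesStableSection/Disproof.lean`.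
-/

set_option linter.dupNamespace false

namespace Summit.PneNP.PneNP.Cruxes.SolvableImpliesStableSection.Negative

open Finset
open Summit.PneNP.PneNP.Theses.OverlapGapAlgebra
open Literature.Computability.Complexity

open scoped Classical in
/-- The complexity-free solver `f*`: on a codeword `x = encode L` it outputs SOME word `y` with
`∀ C ∈ L, ∃ (v, b) ∈ C, y.getD v false = b` whenever one exists (no complexity bound). -/
noncomputable def fStar (x : List Bool) : List Bool :=
  if h : ∃ p : CNF ℕ × List Bool, encodingCNF.encode p.1 = x ∧
      ∀ C ∈ p.1, ∃ l ∈ C, p.2.getD l.1 false = l.2 then (Classical.choose h).2 else []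

/-- `f*` succeeds on every clause list admitting a good word (injectivity of `encodingCNF`). -/
theorem fStar_good (L : CNF ℕ) (y : List Bool) (hy : ∀ C ∈ L, ∃ l ∈ C, y.getD l.1 false = l.2) :
    ∀ C ∈ L, ∃ l ∈ C, (fStar (encodingCNF.encode L)).getD l.1 false = l.2 := by
  classical
  have h : ∃ p : CNF ℕ × List Bool, encodingCNF.encode p.1 = encodingCNF.encode L ∧
      ∀ C ∈ p.1, ∃ l ∈ C, p.2.getD l.1 false = l.2 := ⟨(L, y), rfl, hy⟩
  unfold fStar
  rw [dif_pos h]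
  obtain ⟨h1, h2⟩ := Classical.choose_spec h
  rwa [encodingCNF.encode_injective h1] at h2

/-- `f*` solves (in the crux's sense) every satisfiable typed instance `Φ`. -/
theorem fStar_solves {k m n : ℕ} (Φ : Fin m → Fin k → Fin n × Bool)
    (hΦ : ∃ σ : Fin n → Bool, ∀ i, ∃ j, σ (Φ i j).1 = (Φ i j).2) :
    ∀ i, ∃ j, (fStar (encodingCNF.encode (List.ofFn fun a =>
      List.ofFn fun b => (((Φ a b).1 : ℕ), (Φ a b).2)))).getD (Φ i j).1 false = (Φ i j).2 := by
  obtain ⟨σ, hσ⟩ := hΦ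
  set L : CNF ℕ := List.ofFn fun a => List.ofFn fun b => (((Φ a b).1 : ℕ), (Φ a b).2) with hL
  have hyget : ∀ v : Fin n, (List.ofFn σ).getD v false = σ v := by
    intro v
    simp [List.getD_eq_getElem?_getD]
  have hgood : ∀ C ∈ L, ∃ l ∈ C, (List.ofFn σ).getD l.1 false = l.2 := by
    intro C hC
    rw [hL, List.mem_ofFn] at hC
    obtain ⟨a, rfl⟩ := hC
    obtain ⟨b, hb⟩ := hσ a
    refine ⟨(((Φ a b).1 : ℕ), (Φ a b).2), List.mem_ofFn.2 ⟨b, rfl⟩, ?_⟩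
    change (List.ofFn σ).getD ((Φ a b).1 : ℕ) false = (Φ a b).2
    rw [hyget]
    exact hb
  have hstar := fStar_good L _ hgood
  intro i
  have hCi : (List.ofFn fun b => (((Φ i b).1 : ℕ), (Φ i b).2)) ∈ L := by
    rw [hL, List.mem_ofFn]
    exact ⟨i, rfl⟩
  obtain ⟨l, hl, hval⟩ := hstar _ hCi
  rw [List.mem_ofFn] at hl
  obtain ⟨j, rfl⟩ := hl
  exact ⟨j, hval⟩

/-- **`SolvableImpliesStableSection` is false without `IsPolyTime`, given the route's two printed
theorems** (`SolvableImpliesStableSection_false_without_IsPolyTime`): `NoStableSection` (item 2462)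
and `PositiveSatProbability` (item 2464) refute the crux with the efficiency conjunct deleted — in the
Bresler–Huang window the complexity-free solver `fStar` meets the weakened hypothesis while every
section fails.  Hence `IsPolyTime f` is load-bearing: any proof of the crux must use the polynomial-time
machine of `f` white-box. -/
theorem solvableImpliesStableSection_false_without_polyTime_of
    (hNo : NoStableSection) (hPos : PositiveSatProbability) :
    ¬ (∀ k : ℕ, 3 ≤ k → ∀ α η ν : ℝ, 0 < α → 0 < η → 0 < ν →
      (∃ f : List Bool → List Bool, ∃ ε : ℝ, 0 < ε ∧
        ∃ᶠ n : ℕ in Filter.atTop, ∀ m : ℕ, m = ⌊α * n⌋₊ → ε ≤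
          ((Finset.univ.filter fun Φ : Fin m → Fin k → Fin n × Bool => ∀ i, ∃ j,
            (f (Literature.Computability.Complexity.encodingCNF.encode (List.ofFn fun a =>
              List.ofFn fun b => (((Φ a b).1 : ℕ), (Φ a b).2)))).getD (Φ i j).1 false =
                (Φ i j).2).card : ℝ) / Fintype.card (Fin m → Fin k → Fin n × Bool)) →
      ∀ c : ℝ, 0 < c → ∃ᶠ n : ℕ in Filter.atTop, ∀ m : ℕ, m = ⌊α * n⌋₊ →
        ∃ g : (Fin m → Fin k → Fin n × Bool) → (Fin n → Bool),
          Real.exp (-(c * n)) * Fintype.card (Fin (k + 1) → Fin m → Fin k → Fin n × Bool) ≤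
          ((Finset.univ.filter fun Ψ : Fin (k + 1) → Fin m → Fin k → Fin n × Bool =>
            let P : Fin k → ℕ → Fin m → Fin k → Fin n × Bool :=
              fun r q a b => if (a : ℕ) * k + b < q then Ψ r.succ a b else Ψ r.castSucc a b
            (∀ r : Fin k, ∀ q ≤ m * k, ((Finset.univ.filter fun i : Fin m =>
              ∀ j, g (P r q) (P r q i j).1 ≠ (P r q i j).2).card : ℝ) ≤ ν * m) ∧
            ∀ r : Fin k, ∀ q < m * k,
              (hammingDist (g (P r q)) (g (P r (q + 1))) : ℝ) ≤ η * n).card : ℝ)) := by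
  intro hT
  obtain ⟨k₀, hk₀⟩ := hNo
  obtain ⟨k₁, hk₁⟩ := hPos
  obtain ⟨k, hk0, hk1, hk3⟩ : ∃ k : ℕ, k₀ ≤ k ∧ k₁ ≤ k ∧ 3 ≤ k :=
    ⟨max (max k₀ k₁) 3, le_trans (le_max_left _ _) (le_max_left _ _),
      le_trans (le_max_right _ _) (le_max_left _ _), le_max_right _ _⟩
  obtain ⟨η, hη, ν, hν, c, hc, hev⟩ := hk₀ k hk0
  obtain ⟨ε, hε, hsat⟩ := hk₁ k hk1
  -- positivity of the window density `α = 5·2^k·log k/k` (uses `k ≥ 3`)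
  have hk1' : (1 : ℝ) < k := by exact_mod_cast (by omega : 1 < k)
  have hkpos : (0 : ℝ) < k := by linarith
  have hlog : 0 < Real.log k := Real.log_pos hk1'
  have hα : (0 : ℝ) < 5 * 2 ^ k * Real.log k / k :=
    div_pos (mul_pos (mul_pos (by norm_num) (by positivity)) hlog) hkpos
  -- `fStar` meets the weakened hypothesis: its success set contains the satisfiable instances
  have hsolv : ∃ f : List Bool → List Bool, ∃ ε : ℝ, 0 < ε ∧
      ∃ᶠ n : ℕ in Filter.atTop, ∀ m : ℕ, m = ⌊5 * 2 ^ k * Real.log k / k * n⌋₊ → ε ≤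
        ((Finset.univ.filter fun Φ : Fin m → Fin k → Fin n × Bool => ∀ i, ∃ j,
          (f (Literature.Computability.Complexity.encodingCNF.encode (List.ofFn fun a =>
            List.ofFn fun b => (((Φ a b).1 : ℕ), (Φ a b).2)))).getD (Φ i j).1 false =
              (Φ i j).2).card : ℝ) / Fintype.card (Fin m → Fin k → Fin n × Bool) := by
    refine ⟨fStar, ε, hε, Filter.Eventually.frequently (hsat.mono fun n hn m hm => ?_)⟩
    refine (hn m hm).trans (div_le_div_of_nonneg_right ?_ (Nat.cast_nonneg _))
    exact_mod_cast Finset.card_le_card fun Φ hΦ => by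
      simp only [Finset.mem_filter, Finset.mem_univ, true_and] at hΦ ⊢
      exact fStar_solves Φ hΦ
  -- the weakened crux, fed with `fStar` and the rate `c/2`
  have key := hT k hk3 (5 * 2 ^ k * Real.log k / k) η ν hα hη hν hsolv (c / 2) (half_pos hc)
  refine Filter.frequently_false (Filter.atTop : Filter ℕ)
    ((key.and_eventually (hev.and (Filter.eventually_ge_atTop 1))).mono ?_)
  rintro n ⟨h₁, h₂, hn1⟩
  obtain ⟨g, hg⟩ := h₁ _ rfl
  have hg' := h₂ _ rfl g
  have hcard := card_paths_pos k ⌊5 * 2 ^ k * Real.log k / k * (n : ℝ)⌋₊ hn1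
  have hle : Real.exp (-(c / 2 * n)) ≤ Real.exp (-(c * n)) :=
    le_of_mul_le_mul_right (hg.trans hg') hcard
  have hn' : (1 : ℝ) ≤ n := by exact_mod_cast hn1
  have := Real.exp_le_exp.1 hle
  nlinarith

end Summit.PneNP.PneNP.Cruxes.SolvableImpliesStableSection.Negative
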